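/-
Origin: expansion seat `planner-pub-hodgecm-pohl-g13-0`, handover #4 2026-08-18T13:31:19Z (md5 9c651f9b2b227738aeeaab3daf2b0905, 343 l. — supersedes the CLAIM bytes 32858c6b (+ K₂ corollary); RUN 30 additive leaf; lands AFTER my #2 HodgeCM/Proofs/Pohlmann/GaloisSpanAntiSpace.lean (b7394864) (independent of #3); rewrite import Pohl13.GaloisSpanAntiSpace -> HodgeCM.Proofs.Pohlmann.GaloisSpanAntiSpace x1) (`HOME/pub-hodgecm-pohl-g13/lean/Pohl13/GaloisSpanQuartic.lean`, md5 9c651f9b, 343 lines);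
landed by the gen-8 packager in gate run 30 as `HodgeCM/Proofs/Pohlmann/GaloisSpanQuartic.lean` (import ^import Pohl13\.GaloisSpanAntiSpace[ \t]*$→import HodgeCM.Proofs.Pohlmann.GaloisSpanAntiSpace ×1).
-/
/-
Copyright: pub-hodgecm formalisation cell (harness21, 2026). New file (not vendored).
Origin: HOME/pub-hodgecm-pohl-g13/lean/Pohl13/GaloisSpanQuartic.lean — session planner-pub-hodgecm-pohl-g13-0 (unit pub-hodgecm-pohl-g13),
EXPANSION part (b) `PohlmannSpan`, generation 13, file 4.  Intended final place: `HodgeCM/Proofs/Pohlmann/GaloisSpanQuartic.lean`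
(module `HodgeCM.Proofs.Pohlmann.GaloisSpanQuartic`).  ADDITIVE leaf.  WIP import `Pohl13.GaloisSpanAntiSpace` = this seat's file 2
`HodgeCM/Proofs/Pohlmann/GaloisSpanAntiSpace.lean` (rewrite to `import HodgeCM.Proofs.Pohlmann.GaloisSpanAntiSpace` on landing).
-/
import Summits.HodgeConjecture.HodgeCM.Proofs.Pohlmann.GaloisSpanAntiSpace

/-!
# Sign changes in the Galois image, and the Galois span condition for QUARTIC CM fields

File 1 (`GaloisSpanCriterion.lean`) reduced "the naive Pohlmann span holds for every family of CM types of `F`" to the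
GALOIS SPAN CONDITION LIN(F) (`NonGalois.GalSpanCondition F n`); file 2 (`GaloisSpanAntiSpace.lean`) proved the swap identity
`2 e_{s₀ x₀} = a_σ − a_{τ_{x₀} ∘ σ}` and transitivity of `Gal(E^c/ℚ)` on `Hom(F, ℂ)`.  This file draws the consequences for the
permutation image of the Galois group and settles the QUARTIC case completely.

* `NonGalois.galSpanCondition_of_galF_eq_swap` — **one sign change suffices**: if some `σ₀ ∈ Gal(E^c/ℚ)` acts on `Hom(F, ℂ)` as a
  sign change `t ↔ t̄` (everything else fixed), then the `a_σ` span the anti-space (`antiSpace_le_galAntiSpan_of_galF_eq_swap`)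
  and LIN(F) holds at every level — for any CM field, with no hypothesis on `Aut(F/ℚ)` (all sign changes are then in the image by
  transitivity, `exists_galF_eq_swap`, and the swap identity applies inside the image).
* `NonGalois.eq_one_of_forall_galF_eq` — `Gal(E^c/ℚ)` acts FAITHFULLY on `Hom(F, ℂ)` (`E^c` is generated by the `s(F)`);
  `NonGalois.isGalois_galoisClosure` — `E^c/ℚ` is Galois (`#Aut = [E^c:ℚ]` via `GaoUllmo.autOfEmb`);
  `NonGalois.exists_galF_eq_self_and_ne_id` — if `F/ℚ` is NOT Galois, the stabiliser of `s₀` (the fixing subgroup of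
  `s₀(F) ⊆ E^c`, `embRange`) acts non-trivially on `Hom(F, ℂ)` (Galois correspondence: a trivial fixing subgroup would make
  `s₀ : F ≃ E^c`, so `F` Galois).
* `NonGalois.exists_galF_eq_swap_of_finrank_eq_four` — for `[F:ℚ] = 4` a non-trivial element of the stabiliser of `s₀` IS the
  sign change at the other conjugate pair (`Hom(F, ℂ) = {s₀, s̄₀, t, t̄}`).
* **THEOREM** `NonGalois.galSpanCondition_of_finrank_eq_four` — EVERY quartic CM field satisfies LIN (Galois: file 1; non-Galois:
  the three items above); `indexSetsAgree_of_finrank_eq_four` — hence agreeing index sets at every `(m, Θ, p)`;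
  `Universe.naivePohlmannSpanAt_of_finrank_eq_four` — under the model axioms and N1–N3 the naive Pohlmann span holds for every
  family of CM types of every quartic CM field (powers and products of CM abelian surfaces with CM by `F`).

So the first failures of the naive span live in degree `6` (pohl-g11/g12's sextic `K₂`, Galois closure of order `12`; by the
first item NO element of `Gal(K₂^c/ℚ)` acts as a single sign change: `Universe.not_exists_galF_eq_swap_K₂`).
Nothing is posited; nothing is cited; Galois theory (Mathlib's fundamental theorem `IsGalois.fixedField_fixingSubgroup`) and the
linear algebra of files 1–2.
-/

noncomputable section

open scoped TensorProduct NumberField BigOperators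
open NumberField NumberField.ComplexEmbedding

attribute [local instance] Classical.propDecidable

namespace HodgeCM

open Literature.AlgebraicGeometry.Motives (CMType HodgeStructure)
open HodgeCM.Pohlmann HodgeCM.GaoUllmo HodgeCM.CMTypeOps

namespace NonGalois

/-! ### One sign change in the Galois image forces the Galois span condition -/

section Swap

variable {F : Type} [Field F] [NumberField F] {n : ℕ}

/-- (Ported verbatim from the HodgeCMPerL package; no docstring in the source.) -/
theorem coe_galTOf (σ : galoisClosure (Fin (n + 1) → F) ≃ₐ[ℚ] galoisClosure (Fin (n + 1) → F)) :
    ⇑(galTOf σ).1 = galF n σ := rfl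

/-- (Ported verbatim from the HodgeCMPerL package; no docstring in the source.) -/
theorem galTOf_fst_mul (σ' σ : galoisClosure (Fin (n + 1) → F) ≃ₐ[ℚ] galoisClosure (Fin (n + 1) → F)) :
    (galTOf (σ' * σ)).1 = (galTOf σ').1 * (galTOf σ).1 :=
  Equiv.ext fun s => by rw [Equiv.Perm.mul_apply, galTOf_apply, galTOf_apply, galTOf_apply, galF_mul]

/-- (Ported verbatim from the HodgeCMPerL package; no docstring in the source.) -/
theorem galTOf_fst_inv (σ : galoisClosure (Fin (n + 1) → F) ≃ₐ[ℚ] galoisClosure (Fin (n + 1) → F)) :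
    (galTOf σ⁻¹).1 = ((galTOf σ).1)⁻¹ :=
  eq_inv_of_mul_eq_one_left (by rw [← galTOf_fst_mul, inv_mul_cancel]; exact Equiv.ext fun s => galF_one s)

variable [IsCMField F]

/-- If some `σ₀ ∈ Gal(E^c/ℚ)` acts on `Hom(F, ℂ)` as the sign change `t ↔ t̄`, then (transitivity) EVERY sign change
`x ↔ x̄` is realised by a conjugate of `σ₀`. -/
theorem exists_galF_eq_swap {t : F →+* ℂ} {σ₀ : galoisClosure (Fin (n + 1) → F) ≃ₐ[ℚ] galoisClosure (Fin (n + 1) → F)}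
    (h : galF n σ₀ = Equiv.swap t (conjugate t)) (x : F →+* ℂ) :
    ∃ σ : galoisClosure (Fin (n + 1) → F) ≃ₐ[ℚ] galoisClosure (Fin (n + 1) → F), galF n σ = Equiv.swap x (conjugate x) := by
  obtain ⟨σ₁, hσ₁⟩ := exists_galF_apply_eq (n := n) t x
  refine ⟨σ₁ * σ₀ * σ₁⁻¹, ?_⟩
  have h0 : (galTOf σ₀).1 = Equiv.swap t (conjugate t) := Equiv.ext fun s => by rw [galTOf_apply, h]
  have h1 : (galTOf (σ₁ * σ₀ * σ₁⁻¹)).1 = Equiv.swap x (conjugate x) := by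
    rw [galTOf_fst_mul, galTOf_fst_mul, galTOf_fst_inv, h0, ← Equiv.swap_apply_apply, galTOf_apply, galTOf_apply, hσ₁,
      (isBarCommuting_galF σ₁) t, hσ₁]
  rw [← coe_galTOf, h1]

/-- **One sign change suffices.**  If some element of `Gal(E^c/ℚ)` acts on `Hom(F, ℂ)` as a sign change `t ↔ t̄` (all other
embeddings fixed), then the `a_σ` span the anti-space, hence the Galois span condition holds (for a CM field; no hypothesis on
`Aut(F/ℚ)`).  Proof: the swap identity `2 e_{s₀ x₀} = a_σ − a_{τ_{x₀} σ}` of file 2 with `τ_{x₀}` now IN the Galois image. -/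
theorem antiSpace_le_galAntiSpan_of_galF_eq_swap {t : F →+* ℂ}
    {σ₀ : galoisClosure (Fin (n + 1) → F) ≃ₐ[ℚ] galoisClosure (Fin (n + 1) → F)} (h : galF n σ₀ = Equiv.swap t (conjugate t)) :
    antiSpace F ≤ galAntiSpan F n := by
  rw [antiSpace_eq_span_elemAnti, Submodule.span_le]
  rintro _ ⟨⟨s₀, x₀⟩, rfl⟩
  obtain ⟨σ, hσ⟩ := exists_galF_apply_eq (n := n) s₀ x₀
  obtain ⟨τ, hτ⟩ := exists_galF_eq_swap h x₀
  have h1 : antiInd (galF n σ) ∈ galAntiSpan F n := antiInd_galF_mem_galAntiSpan σ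
  have h2 : antiInd (fun s => Equiv.swap x₀ (conjugate x₀) (galF n σ s)) ∈ galAntiSpan F n := by
    have h3 : (fun s => Equiv.swap x₀ (conjugate x₀) (galF n σ s)) = galF n (τ * σ) :=
      funext fun s => by rw [galF_mul, hτ]
    rw [h3]
    exact antiInd_galF_mem_galAntiSpan (τ * σ)
  have key := antiInd_sub_antiInd_swap (isBarCommuting_galF σ) (galF_injective σ) hσ
  have h4 : elemAnti s₀ x₀ = (2 : ℚ)⁻¹ • (antiInd (galF n σ) - antiInd (fun s => Equiv.swap x₀ (conjugate x₀) (galF n σ s))) := by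
    rw [key, smul_smul]
    norm_num
  show elemAnti s₀ x₀ ∈ galAntiSpan F n
  rw [h4]
  exact Submodule.smul_mem _ _ (Submodule.sub_mem _ h1 h2)

/-- (Ported verbatim from the HodgeCMPerL package; no docstring in the source.) -/
theorem galSpanCondition_of_galF_eq_swap {t : F →+* ℂ}
    {σ₀ : galoisClosure (Fin (n + 1) → F) ≃ₐ[ℚ] galoisClosure (Fin (n + 1) → F)} (h : galF n σ₀ = Equiv.swap t (conjugate t))
    (m : ℕ) : GalSpanCondition F m :=
  (galSpanCondition_iff n m).mp (galSpanCondition_of_antiSpace_le (antiSpace_le_galAntiSpan_of_galF_eq_swap h))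

end Swap

/-! ### `Gal(E^c/ℚ)` acts faithfully on `Hom(F, ℂ)`; `E^c` is Galois; a non-Galois `F` has a non-trivial stabiliser -/

section Faithful

variable {F : Type} [Field F] [NumberField F] {n : ℕ}

/-- The element `s(a) ∈ E^c`. -/
theorem galF_apply_eq_coe (σ : galoisClosure (Fin (n + 1) → F) ≃ₐ[ℚ] galoisClosure (Fin (n + 1) → F)) (s : F →+* ℂ) (a : F) :
    galF n σ s a = (σ ⟨s a, apply_mem_galoisClosure (n := n) s a⟩ : ℂ) := rfl

/-- **Faithfulness**: an element of `Gal(E^c/ℚ)` acting trivially on `Hom(F, ℂ)` is trivial (`E^c` is generated by the `s(F)`). -/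
theorem eq_one_of_forall_galF_eq {σ : galoisClosure (Fin (n + 1) → F) ≃ₐ[ℚ] galoisClosure (Fin (n + 1) → F)}
    (h : ∀ s : F →+* ℂ, galF n σ s = s) : σ = 1 := by
  have key : ∀ x : galoisClosure (Fin (n + 1) → F), (σ x : ℂ) = x := by
    intro x
    obtain ⟨x, hx⟩ := x
    induction hx using IntermediateField.adjoin_induction with
    | mem z hz =>
      obtain ⟨φ, ⟨a, rfl⟩⟩ := Set.mem_iUnion.mp hz
      obtain ⟨j, s, rfl⟩ := exists_eq_piEmb φ
      have h1 : (⟨piEmb j s a, IntermediateField.subset_adjoin ℚ _ hz⟩ : galoisClosure (Fin (n + 1) → F)) =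
          ⟨s (a j), apply_mem_galoisClosure (n := n) s (a j)⟩ := Subtype.ext (piEmb_apply j s a)
      rw [h1, ← galF_apply_eq_coe, h s]
    | algebraMap q =>
      have : (⟨algebraMap ℚ ℂ q, IntermediateField.algebraMap_mem _ q⟩ : galoisClosure (Fin (n + 1) → F)) =
          algebraMap ℚ (galoisClosure (Fin (n + 1) → F)) q := rfl
      rw [this, AlgEquiv.commutes]
    | add x y hx hy ihx ihy =>
      have : (⟨x + y, add_mem hx hy⟩ : galoisClosure (Fin (n + 1) → F)) = ⟨x, hx⟩ + ⟨y, hy⟩ := rfl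
      rw [this, map_add, IntermediateField.coe_add, ihx, ihy]
      rfl
    | inv x hx ihx =>
      have : (⟨x⁻¹, inv_mem hx⟩ : galoisClosure (Fin (n + 1) → F)) = (⟨x, hx⟩ : galoisClosure (Fin (n + 1) → F))⁻¹ := rfl
      rw [this, map_inv₀, IntermediateField.coe_inv, ihx]
      rfl
    | mul x y hx hy ihx ihy =>
      have : (⟨x * y, mul_mem hx hy⟩ : galoisClosure (Fin (n + 1) → F)) = ⟨x, hx⟩ * ⟨y, hy⟩ := rfl
      rw [this, map_mul, IntermediateField.coe_mul, ihx, ihy]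
      rfl
  exact AlgEquiv.ext fun x => Subtype.ext (key x)

/-- (Ported verbatim from the HodgeCMPerL package; no docstring in the source.) -/
theorem galF_eq_id_iff {σ : galoisClosure (Fin (n + 1) → F) ≃ₐ[ℚ] galoisClosure (Fin (n + 1) → F)} :
    galF n σ = id ↔ σ = 1 :=
  ⟨fun h => eq_one_of_forall_galF_eq fun s => congr_fun h s, fun h => funext fun s => by rw [h, galF_one, id]⟩

/-- `E^c` is a number field. -/
instance numberField_galoisClosure : NumberField (galoisClosure (Fin (n + 1) → F)) := NumberField.mk

/-- `E^c/ℚ` is Galois (`#Aut(E^c) = [E^c:ℚ]`: every complex embedding of `E^c` is an automorphism, `autOfEmb`). -/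
instance isGalois_galoisClosure : IsGalois ℚ (galoisClosure (Fin (n + 1) → F)) := by
  apply IsGalois.of_card_aut_eq_finrank
  rw [Nat.card_eq_fintype_card]
  apply le_antisymm
  · rw [← NumberField.Embeddings.card (galoisClosure (Fin (n + 1) → F)) ℂ]
    refine Fintype.card_le_of_injective
      (fun σ : galoisClosure (Fin (n + 1) → F) ≃ₐ[ℚ] galoisClosure (Fin (n + 1) → F) =>
        ((galoisClosure (Fin (n + 1) → F)).val : galoisClosure (Fin (n + 1) → F) →+* ℂ).comp
          (σ : galoisClosure (Fin (n + 1) → F) →+* galoisClosure (Fin (n + 1) → F))) ?_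
    intro σ σ' hσ
    apply AlgEquiv.ext
    intro x
    apply Subtype.ext
    exact RingHom.congr_fun hσ x
  · rw [← NumberField.Embeddings.card (galoisClosure (Fin (n + 1) → F)) ℂ]
    refine Fintype.card_le_of_injective (fun ρ : galoisClosure (Fin (n + 1) → F) →+* ℂ => autOfEmb ρ.toRatAlgHom) ?_
    intro ρ ρ' hρ
    apply RingHom.ext
    intro x
    have h1 := congrArg (fun σ : galoisClosure (Fin (n + 1) → F) ≃ₐ[ℚ] galoisClosure (Fin (n + 1) → F) => (σ x : ℂ)) hρ
    exact h1

/-- The image `s₀(F) ⊆ E^c` as an intermediate field. -/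
def embRange (n : ℕ) (s₀ : F →+* ℂ) : IntermediateField ℚ (galoisClosure (Fin (n + 1) → F)) :=
  (((corestrict (Fin (n + 1) → F) (piEmb 0 s₀) : (Fin (n + 1) → F) →+* galoisClosure (Fin (n + 1) → F)).comp
    piDiag).toRatAlgHom).fieldRange

/-- (Ported verbatim from the HodgeCMPerL package; no docstring in the source.) -/
theorem mem_embRange (s₀ : F →+* ℂ) (a : F) :
    (⟨s₀ a, apply_mem_galoisClosure (n := n) s₀ a⟩ : galoisClosure (Fin (n + 1) → F)) ∈ embRange n s₀ :=
  ⟨a, rfl⟩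

/-- An element of `Gal(E^c/ℚ)` fixing `s₀(F)` pointwise fixes `s₀`. -/
theorem galF_eq_self_of_mem_fixingSubgroup {s₀ : F →+* ℂ}
    {σ : galoisClosure (Fin (n + 1) → F) ≃ₐ[ℚ] galoisClosure (Fin (n + 1) → F)} (hσ : σ ∈ (embRange n s₀).fixingSubgroup) :
    galF n σ s₀ = s₀ := by
  rw [IntermediateField.mem_fixingSubgroup_iff] at hσ
  refine RingHom.ext fun a => ?_
  rw [galF_apply_eq_coe, hσ _ (mem_embRange s₀ a)]

/-- If `F/ℚ` is NOT Galois, the stabiliser of `s₀` in `Gal(E^c/ℚ)` acts non-trivially on `Hom(F, ℂ)`. -/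
theorem exists_galF_eq_self_and_ne_id (hF : ¬ IsGalois ℚ F) (s₀ : F →+* ℂ) :
    ∃ σ : galoisClosure (Fin (n + 1) → F) ≃ₐ[ℚ] galoisClosure (Fin (n + 1) → F), galF n σ s₀ = s₀ ∧ galF n σ ≠ id := by
  have hne : (embRange n s₀).fixingSubgroup ≠ ⊥ := by
    intro hbot
    apply hF
    have htop : embRange n s₀ = ⊤ := by
      rw [← IsGalois.fixedField_fixingSubgroup (embRange n s₀), hbot, IntermediateField.fixedField_bot]
    let j : F →ₐ[ℚ] galoisClosure (Fin (n + 1) → F) :=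
      ((corestrict (Fin (n + 1) → F) (piEmb 0 s₀) : (Fin (n + 1) → F) →+* galoisClosure (Fin (n + 1) → F)).comp
        piDiag).toRatAlgHom
    have hsurj : Function.Surjective j := AlgHom.fieldRange_eq_top.mp htop
    have e : F ≃ₐ[ℚ] galoisClosure (Fin (n + 1) → F) := AlgEquiv.ofBijective j ⟨j.toRingHom.injective, hsurj⟩
    exact IsGalois.of_algEquiv e.symm
  obtain ⟨⟨σ, hσ⟩, hσ1⟩ := Subgroup.ne_bot_iff_exists_ne_one.mp hne
  refine ⟨σ, galF_eq_self_of_mem_fixingSubgroup hσ, fun h => hσ1 (Subtype.ext ?_)⟩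
  exact galF_eq_id_iff.mp h

end Faithful

/-! ### Quartic CM fields -/

section Quartic

variable {F : Type} [Field F] [NumberField F] {n : ℕ}

/-- In a totally complex quartic field there is an embedding outside any conjugate pair … -/
theorem exists_ne_pair [IsTotallyComplex F] (h4 : Module.finrank ℚ F = 4) (s₀ : F →+* ℂ) :
    ∃ t : F →+* ℂ, t ≠ s₀ ∧ t ≠ conjugate s₀ := by
  by_contra hcon
  have hsub : (Finset.univ : Finset (F →+* ℂ)) ⊆ {s₀, conjugate s₀} := by
    intro t _
    rw [Finset.mem_insert, Finset.mem_singleton]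
    by_cases ht : t = s₀
    · exact Or.inl ht
    · by_contra ht'
      exact hcon ⟨t, ht, fun h => ht' (Or.inr h)⟩
  have h1 := Finset.card_le_card hsub
  rw [Finset.card_univ, NumberField.Embeddings.card, h4] at h1
  have h2 : ({s₀, conjugate s₀} : Finset (F →+* ℂ)).card ≤ 2 := Finset.card_le_two
  omega

/-- … and then `Hom(F, ℂ) = {s₀, s̄₀, t, t̄}`. -/
theorem eq_or_eq_or_eq_or_eq [IsTotallyComplex F] (h4 : Module.finrank ℚ F = 4) {s₀ t : F →+* ℂ} (ht₁ : t ≠ s₀)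
    (ht₂ : t ≠ conjugate s₀) (y : F →+* ℂ) : y = s₀ ∨ y = conjugate s₀ ∨ y = t ∨ y = conjugate t := by
  have h01 : s₀ ≠ conjugate s₀ := (conjugate_ne s₀).symm
  have h02 : s₀ ≠ t := ht₁.symm
  have h03 : s₀ ≠ conjugate t := fun h => ht₂ (by rw [h, (involutive_conjugate F) t])
  have h12 : conjugate s₀ ≠ t := fun h => ht₂ h.symm
  have h13 : conjugate s₀ ≠ conjugate t := fun h => ht₁ ((involutive_conjugate F).injective h).symm
  have h23 : t ≠ conjugate t := (conjugate_ne t).symm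
  have hQ : ({s₀, conjugate s₀, t, conjugate t} : Finset (F →+* ℂ)) = Finset.univ := by
    apply Finset.eq_univ_of_card
    rw [NumberField.Embeddings.card, h4, Finset.card_insert_of_notMem, Finset.card_insert_of_notMem,
      Finset.card_insert_of_notMem, Finset.card_singleton]
    · rw [Finset.mem_singleton]; exact h23
    · rw [Finset.mem_insert, Finset.mem_singleton]; exact not_or.mpr ⟨h12, h13⟩
    · rw [Finset.mem_insert, Finset.mem_insert, Finset.mem_singleton]; exact not_or.mpr ⟨h01, not_or.mpr ⟨h02, h03⟩⟩
  have hy : y ∈ ({s₀, conjugate s₀, t, conjugate t} : Finset (F →+* ℂ)) := by rw [hQ]; exact Finset.mem_univ y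
  simpa only [Finset.mem_insert, Finset.mem_singleton] using hy

variable [IsCMField F]

/-- **Quartic fields: a non-trivial element of the stabiliser of `s₀` is the sign change at the other pair.** -/
theorem exists_galF_eq_swap_of_finrank_eq_four (h4 : Module.finrank ℚ F = 4) {s₀ : F →+* ℂ}
    {σ : galoisClosure (Fin (n + 1) → F) ≃ₐ[ℚ] galoisClosure (Fin (n + 1) → F)} (hs₀ : galF n σ s₀ = s₀) (hne : galF n σ ≠ id) :
    ∃ t : F →+* ℂ, galF n σ = Equiv.swap t (conjugate t) := by
  obtain ⟨t, ht₁, ht₂⟩ := exists_ne_pair h4 s₀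
  have hbar := isBarCommuting_galF σ
  have hinj := galF_injective σ
  have hcs₀ : galF n σ (conjugate s₀) = conjugate s₀ := by rw [hbar, hs₀]
  have hσt : galF n σ t = conjugate t := by
    rcases eq_or_eq_or_eq_or_eq h4 ht₁ ht₂ (galF n σ t) with h | h | h | h
    · exact absurd (hinj (h.trans hs₀.symm)) ht₁
    · exact absurd (hinj (h.trans hcs₀.symm)) ht₂
    · exfalso
      refine hne (funext fun y => ?_)
      show galF n σ y = y
      rcases eq_or_eq_or_eq_or_eq h4 ht₁ ht₂ y with rfl | rfl | rfl | rfl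
      · exact hs₀
      · exact hcs₀
      · exact h
      · rw [hbar, h]
    · exact h
  refine ⟨t, funext fun y => ?_⟩
  rcases eq_or_eq_or_eq_or_eq h4 ht₁ ht₂ y with rfl | rfl | rfl | rfl
  · rw [hs₀, Equiv.swap_apply_of_ne_of_ne ht₁.symm fun h => ht₂ (by rw [h, (involutive_conjugate F) t])]
  · rw [hcs₀, Equiv.swap_apply_of_ne_of_ne (fun h => ht₂ h.symm) fun h => ht₁ ((involutive_conjugate F).injective h).symm]
  · rw [hσt, Equiv.swap_apply_left]
  · rw [hbar, hσt, (involutive_conjugate F) t, Equiv.swap_apply_right]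

/-- **THEOREM (quartic CM fields).**  Every quartic CM field satisfies the Galois span condition: if `F/ℚ` is Galois by file 1
(`galSpanCondition_of_isGalois`); if not, the stabiliser of an embedding in `Gal(E^c/ℚ)` contains a sign change `t ↔ t̄`, and one
sign change suffices (`galSpanCondition_of_galF_eq_swap`). -/
theorem galSpanCondition_of_finrank_eq_four (h4 : Module.finrank ℚ F = 4) (n : ℕ) : GalSpanCondition F n := by
  by_cases hG : IsGalois ℚ F
  · exact galSpanCondition_of_isGalois
  · obtain ⟨s₀⟩ : Nonempty (F →+* ℂ) := by
      have hc : 0 < Fintype.card (F →+* ℂ) := by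
        rw [Embeddings.card]; exact Module.finrank_pos
      exact Fintype.card_pos_iff.mp hc
    obtain ⟨σ, hσ, hne⟩ := exists_galF_eq_self_and_ne_id (n := 0) hG s₀
    obtain ⟨t, ht⟩ := exists_galF_eq_swap_of_finrank_eq_four h4 hσ hne
    exact galSpanCondition_of_galF_eq_swap ht n

/-- Hence every quartic CM field has agreeing index sets at every `(m, Θ, p)` (pohl-g12's `IndexSetsAgree`). -/
theorem indexSetsAgree_of_finrank_eq_four (h4 : Module.finrank ℚ F = 4) {m : ℕ} (Θ : Fin (m + 1) → CMType F) (p : ℕ) :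
    IndexSetsAgree Θ p :=
  indexSetsAgree_of_galSpanCondition (galSpanCondition_of_finrank_eq_four h4 m) Θ p

end Quartic

end NonGalois

/-! ### Universe level: CM abelian surfaces -/

namespace Universe

open NonGalois SexticCM

variable {U : Universe}

/-- **Every quartic CM field has the naive Pohlmann span** (model axioms + N1–N3): for `[F:ℚ] = 4` and every family `Θ` of CM
types of `F`, the Hodge classes of `A_Θ = ∏_j A_{(F, Θ_j)}` (powers and products of CM abelian SURFACES with CM by `F`) are
spanned over `ℂ` by the weight vectors of the OLD index set `IsHodgeWeight Θ p` — Galois or not. -/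
theorem naivePohlmannSpanAt_of_finrank_eq_four (M : U.ModelAxioms) (hN1 : U.Fact_cupExterior) (hN2 : U.Fact_cup_hodge)
    (hN3 : U.Fact_pull_H0) (F : CMField) (h4 : Module.finrank ℚ F = 4) {n : ℕ} (Θ : Fin (n + 1) → CMType F) (p : ℕ) :
    U.NaivePohlmannSpanAt F Θ p :=
  naivePohlmannSpanAt_of_galSpanCondition M hN1 hN2 hN3 (galSpanCondition_of_finrank_eq_four h4 n) Θ p

/-- pohl-g11's sextic `K₂`: NO element of `Gal(K₂^c/ℚ)` acts on `Hom(K₂, ℂ)` as a single sign change `t ↔ t̄` (at any level). -/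
theorem not_exists_galF_eq_swap_K₂ (n : ℕ) :
    ¬ ∃ (σ : galoisClosure (Fin (n + 1) → K₂CM) ≃ₐ[ℚ] galoisClosure (Fin (n + 1) → K₂CM)) (t : K₂CM →+* ℂ),
      galF n σ = Equiv.swap t (conjugate t) :=
  fun ⟨_σ, _t, h⟩ => not_galSpanCondition_K₂ n (galSpanCondition_of_galF_eq_swap h n)

end Universe

end HodgeCM
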